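import Summits.ResolutionOfSingularities.ResolutionOfSingularities.Theorems.MarkedTransferCampaignW46MohWindowShadeAnchor
import Summits.ResolutionOfSingularities.ResolutionOfSingularities.Theorems.MarkedTransferCampaignW46MohWindowShadeCleaning
import HarnessLib

/-!
# [OURS · L1 W4.6 rung (iii-2), ENTRANCE DOOR, brick 3] The ring-level step of a polynomial anchor under a point blow-up:
# pulled-back window equation = (exceptional parameter)^p · (new anchor equation), the new residual polynomial being
# EXACTLY `PointBlowup.step`

Cell `res-hironaka`, LADDER-RESOLUTION rung L (D-0089), slot W4.6 rung (iii); seat res-L1-s46-pv-6 (gen 4). Host route MarkedTransfer,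
`--supports stmt-ResolutionOfSingularities-16155 --as helper`; kind proof (no definition).

WHY. Along an infinite permissible sequence the ENTRANCE DOOR (this seat, gen 4) carries a polynomial anchor `J_ξ = (w^p + F(y_j, y_i))`
(`…MohWindowShadeAnchor.lean`) from a blown-up point `ξ` to a singular point `ξ′` over it. The SCHEME side (`…MohWindowShadeAnchorStep.lean`,
next brick) presents `𝒪_{Z′,ξ′}` through a Rees chart of the letter `c ∈ {j, i}` with recentred quotients: `ψ(y_c) = X′`,
`ψ(y_c̄) = X′ · (V + a)`, `ψ(w) = X′ · (Ṽ + t)` (`ψ` the stalk map, `a, t ∈ K` the affine coordinates of `ξ′` on the exceptional plane,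
`(X′, V, Ṽ)` a regular system of parameters of `𝒪_{Z′,ξ′}`). This file is the RING side, pure polynomial algebra over this seat's
gen-3 identity `pointTransform · y_c^p = F(y_c, (y_c̄ + a) y_c)` (`MohWindowShadeCleaning.pointTransform_mul_X_pow`) and Hauser's
cleaning over a perfect field (`exists_add_pow_eq_deletePthPowers`):

* `map_anchor_eq_mul_pointTransform` — **(A)** `ψ(w^p + F(y)) = X′^p · (Ṽ^p + (pointTransform p c b s + t^p)(X′, V))`, `b = (c ↦ 0, c̄ ↦ a)`;
* `exists_map_anchor_eq_mul_step` — **(B)** `ψ(w^p + F(y)) = X′^p · (w′^p + (PointBlowup.step p c b s).F (X′, V))` for some `w′` with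
  `Ṽ − w′ − q ∈ (X′, V)` for a constant `q` (so `(X′, V, w′)` is again a regular system of parameters once `w′ ∈ 𝔪`): the new residual
  polynomial of the anchor upstairs IS the model's step — chart `y_c`, point `b`, cleaning included;
* `isEquimultiplePoint_of_le_ordZero_add_C` — **equimultiplicity reading**: if `p ≤ ord₀ (pointTransform + C (t^p))` (what the
  singularity of `ξ′` gives through `…Anchor.natCast_le_ordZero_of_span_le_pow₂`), then `b` is an EQUIMULTIPLE point of the model.

HONEST FRAMING. Nothing here is a statement of H. Hironaka's manuscript [Hironaka2017] (2017-03-23; Th. 16.6 p.84 — scope only, under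
adjudication) and nothing asserts that any statement of it holds. AI-written; AI review is weaker than expert review. No `sorry`; axioms
standard. References: H. Hauser, Bull. AMS 47 (2010) §§F–G (chart transform, cleaning). [Hauser2010] [folklore]
-/

noncomputable section

set_option linter.dupNamespace false -- mandated namespace of this single-conjunct summit

open MvPolynomial

namespace Summit.ResolutionOfSingularities.ResolutionOfSingularities.Theorems

namespace CampaignW46

namespace MohWindowShadeAnchorCore

open Literature.AlgebraicGeometry.Resolution
open Literature.AlgebraicGeometry.Resolution.PointBlowup
open Literature.AlgebraicGeometry.Resolution.Hauser2010
open Literature.Barriers.ResolutionOfSingularities.HauserPerlega (natCast_le_ordZero_iff)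

universe u v

variable {σ : Type*} [Fintype σ] [DecidableEq σ] {K : Type u} [Field K] [DecidableEq K]
variable (p : ℕ) [hp : Fact p.Prime] [CharP K p]
variable {R : Type v} [CommRing R] {L : Type v} [CommRing L]
variable {c c' : σ}

/-! ## §1 (A): the pulled-back anchor equation is `X′^p` times the translated point transform -/

omit [DecidableEq K] [CharP K p] in
/-- **(A)** [OURS · L1 W4.6] NOT a statement of the manuscript. For a state `s` with all monomials of degree `≥ p`, an anchor
`y ↦ e` (`e : σ → R`), `w`, and ring maps `κ : K → R` (constants), `ψ : R → L` (the stalk map) with `ψ(e_c) = X′`,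
`ψ(e_c̄) = X′ (V + ψκ a)`, `ψ(w) = X′ (Ṽ + ψκ t)`:  `ψ(w^p + F(e)) = X′^p · (Ṽ^p + (pointTransform p c b s + C (t^p))(X′, V))` with
`b = (c ↦ 0, c̄ ↦ a)` and the new anchor `c ↦ X′`, `c̄ ↦ V`. [cite: Hauser2010, §F (chart expressions of a point blowup)] -/
theorem map_anchor_eq_mul_pointTransform [CharP L p] (hc : c' ≠ c) (htwo : ∀ l, l = c ∨ l = c') (κ : K →+* R) (ψ : R →+* L)
    (e : σ → R) (w : R) (s : State σ K) (hdeg : ∀ d ∈ s.F.support, p ≤ d.degree) (a t : K) {X' V W : L}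
    (heC : ψ (e c) = X') (heC' : ψ (e c') = X' * (V + ψ (κ a))) (hw : ψ w = X' * (W + ψ (κ t))) :
    ψ (w ^ p + eval₂ κ e s.F) =
      X' ^ p * (W ^ p + eval₂ (ψ.comp κ) (fun l => if l = c then X' else V)
        (pointTransform p c (fun l => if l = c then 0 else a) s + C (t ^ p))) := by
  classical
  set b : σ → K := fun l => if l = c then 0 else a with hb
  set e' : σ → L := fun l => if l = c then X' else V with he'
  have hbc : b c = 0 := by rw [hb]; exact if_pos rfl
  -- the model identity, evaluated at the new anchor
  have hmodel := MohWindowShadeCleaning.pointTransform_mul_X_pow p hc htwo b hbc s hdeg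
  have hev := congrArg (eval₂ (ψ.comp κ) e') hmodel
  rw [eval₂_mul, eval₂_pow, eval₂_X] at hev
  have he'c : e' c = X' := by rw [he']; exact if_pos rfl
  rw [he'c] at hev
  -- the right-hand side is `ψ (F(e))`
  have hrhs : eval₂ (ψ.comp κ) e' (aeval (fun l => if l = c then X c else (X l + C (b l)) * X c) s.F) =
      ψ (eval₂ κ e s.F) := by
    rw [eval₂_comp_left ψ κ e, aeval_eq_bind₁, ← coe_eval₂Hom, eval₂Hom_bind₁, coe_eval₂Hom]
    congr 1
    funext l
    rcases htwo l with rfl | rfl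
    · rw [if_pos rfl, coe_eval₂Hom, eval₂_X, he'c, Function.comp_apply, heC]
    · rw [if_neg hc, coe_eval₂Hom, eval₂_mul, eval₂_add, eval₂_X, eval₂_X, eval₂_C, he'c, Function.comp_apply, heC',
        RingHom.comp_apply]
      simp only [he', hb, if_neg hc]
      ring
  rw [hrhs] at hev
  -- assemble
  rw [map_add, map_pow, hw, ← hev, mul_pow, add_pow_char _ _ p, eval₂_add, eval₂_C, RingHom.comp_apply, map_pow, map_pow]
  ring

/-! ## §2 (B): cleaning — the new residual polynomial is `(PointBlowup.step p c b s).F` -/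

omit [Fintype σ] [DecidableEq K] hp [CharP K p] in
/-- A polynomial without constant term, evaluated at `(X′, V)`, lies in the ideal `(X′, V)`. [folklore] -/
theorem eval₂_mem_span_pair_of_coeff_zero (f : K →+* L) (X' V : L) {Q : MvPolynomial σ K} (hQ : coeff 0 Q = 0) :
    eval₂ f (fun l => if l = c then X' else V) Q ∈ Ideal.span {X', V} := by
  have h := MohWindowShadeAnchor.eval₂_mem_pow_of_forall_le_degree f (Ideal.span {X', V})
    (v := fun l => if l = c then X' else V) (fun l => ?_) Q (n := 1) (fun d hd => ?_)
  · rwa [pow_one] at h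
  · show (if l = c then X' else V) ∈ Ideal.span {X', V}
    split_ifs
    · exact Ideal.subset_span (Set.mem_insert _ _)
    · exact Ideal.subset_span (Set.mem_insert_of_mem _ (Set.mem_singleton _))
  · rw [Nat.one_le_iff_ne_zero]
    intro hd0
    rw [Finsupp.degree_eq_zero_iff] at hd0
    rw [hd0, MvPolynomial.mem_support_iff] at hd
    exact hd hQ

/-- **(B)** [OURS · L1 W4.6] NOT a statement of the manuscript. Under the hypotheses of (A), over a PERFECT `K`:
`ψ(w^p + F(e)) = X′^p · (w′^p + (step p c b s).F (X′, V))` for some `w′ ∈ L`, and `Ṽ − w′ − ψκ(q) ∈ (X′, V)` for some constant `q`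
(`w′ = Ṽ + t − Q(X′, V)` where `pointTransform + Q^p` is the cleaned polynomial). The new residual polynomial upstairs IS the model's
`PointBlowup.step`. [cite: Hauser2010, §G (cleaning of p-th power monomials)] -/
theorem exists_map_anchor_eq_mul_step [CharP L p] [PerfectRing K p] (hc : c' ≠ c) (htwo : ∀ l, l = c ∨ l = c')
    (κ : K →+* R) (ψ : R →+* L) (e : σ → R) (w : R) (s : State σ K) (hdeg : ∀ d ∈ s.F.support, p ≤ d.degree) (a t : K)
    {X' V W : L} (heC : ψ (e c) = X') (heC' : ψ (e c') = X' * (V + ψ (κ a))) (hw : ψ w = X' * (W + ψ (κ t))) :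
    ∃ (w' : L) (q : K), ψ (w ^ p + eval₂ κ e s.F) =
        X' ^ p * (w' ^ p + eval₂ (ψ.comp κ) (fun l => if l = c then X' else V)
          (step p c (fun l => if l = c then 0 else a) s).F) ∧
      W - w' - ψ (κ q) ∈ Ideal.span {X', V} := by
  classical
  have hA := map_anchor_eq_mul_pointTransform p hc htwo κ ψ e w s hdeg a t heC heC' hw
  set b : σ → K := fun l => if l = c then 0 else a with hb
  set e' : σ → L := fun l => if l = c then X' else V with he'
  -- cleaning over the perfect field `K`
  obtain ⟨Q, hQ⟩ := exists_add_pow_eq_deletePthPowers p 1 (pointTransform p c b s)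
  rw [pow_one] at hQ
  have hstepF : (step p c b s).F = deletePthPowers p (pointTransform p c b s) := rfl
  refine ⟨W + ψ (κ t) - eval₂ (ψ.comp κ) e' Q, MvPolynomial.coeff 0 Q - t, ?_, ?_⟩
  · rw [hA, hstepF, ← hQ]
    congr 1
    rw [eval₂_add, eval₂_add, eval₂_C, eval₂_pow, RingHom.comp_apply, map_pow, map_pow, sub_pow_char _ _, add_pow_char _ _ p]
    ring
  · -- `W − w′ − ψκ(q₀ − t) = (Q − C q₀)(X′, V)`
    have hsplit : eval₂ (ψ.comp κ) e' Q = ψ (κ (MvPolynomial.coeff 0 Q)) + eval₂ (ψ.comp κ) e' (Q - C (MvPolynomial.coeff 0 Q)) := by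
      rw [eval₂_sub, eval₂_C, RingHom.comp_apply]; ring
    have hmem := eval₂_mem_span_pair_of_coeff_zero (c := c) (ψ.comp κ) X' V (Q := Q - C (MvPolynomial.coeff 0 Q))
      (by rw [coeff_sub, coeff_C, if_pos rfl, sub_self])
    have : W - (W + ψ (κ t) - eval₂ (ψ.comp κ) e' Q) - ψ (κ (MvPolynomial.coeff 0 Q - t)) =
        eval₂ (ψ.comp κ) e' (Q - C (MvPolynomial.coeff 0 Q)) := by
      rw [hsplit, map_sub, map_sub]; ring
    rw [this]
    exact hmem

/-! ## §3 The equimultiplicity reading -/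

omit [Fintype σ] [DecidableEq K] hp [CharP K p] in
/-- **Equimultiplicity from the order of the recentred point transform.** If `p ≤ ord₀ (pointTransform p c b s + C u)` (as the
singularity of the point upstairs gives, `u = t^p`), then `b` is an equimultiple point of the model: all monomials of the point
transform of degree `1, …, p − 1` vanish. [cite: Hauser2010, §F (equiconstant points)] -/
theorem isEquimultiplePoint_of_le_ordZero_add_C {b : σ → K} {s : State σ K} {u : K}
    (h : (p : ℕ∞) ≤ ordZero (pointTransform p c b s + C u)) : IsEquimultiplePoint p c b s := by
  intro d hd0 hdp
  by_contra hne
  have hmem : d ∈ (pointTransform p c b s + C u).support := by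
    rw [MvPolynomial.mem_support_iff, coeff_add, coeff_C, if_neg (Ne.symm hd0), add_zero]
    exact hne
  have := (natCast_le_ordZero_iff _ p).mp h d hmem
  omega

end MohWindowShadeAnchorCore

end CampaignW46

end Summit.ResolutionOfSingularities.ResolutionOfSingularities.Theorems

end
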